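import Literature.MathematicalPhysics.QuantumFieldTheory.Balaban1983to89.B16
import Literature.MathematicalPhysics.QuantumFieldTheory.Balaban1983to89.B11
import Literature.MathematicalPhysics.QuantumFieldTheory.Balaban1983to89.B16Sect1Wilson
import Literature.MathematicalPhysics.QuantumFieldTheory.Balaban1983to89.B16Sect1Statements
import Literature.MathematicalPhysics.QuantumFieldTheory.Balaban1983to89.B16Sect1Backgrounds
import Literature.MathematicalPhysics.QuantumFieldTheory.Balaban1983to89.B16Lem366Coupling
import Literature.MathematicalPhysics.QuantumFieldTheory.Balaban1983to89.B16Eq14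

/-!
# `Balaban1983to89.B16Carve38Thm1LocalizationHyp` — T. Bałaban, *Large field renormalization. II. Localization,
# exponentiation, and bounds for the 𝐑 operation*, Commun. Math. Phys. **122** (1989) 355–392
# [Balaban1989LargeFieldII]: pp. 355–366 (Introduction: Theorem 1, (0.1); Sect. 1, (1.1)–(1.39): the localization stage
# of the 𝐑 operation, the proof of Proposition 1 [IV], the N-window) — the residual printed statements in hypothesis
# form and ONE bundle keyed to the consumer

statement-level skeleton of published theorems with citation tags; proofs where landed; nothing here is a claim about the
Yang–Mills mass gap

PDF held: `paper:balaban1989-cmp122-large-field-ii` (journal page = PDF page + 354; pp. 355–366 = PDF 1–12).  Every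
quotation below was READ AS AN IMAGE by this seat on the renders
`run/shared/lean/pub/pub-balaban/b2b-balaban-ref1/pages/1989-cmp122-large-field-II/…-p002…p012-x2.png`; the text layer
(`lit read … --pages 1-12`) was used only to locate them.  [IV] = [Balaban1989LargeFieldI], [III] = [Balaban1988Convergent],
[15] = [Balaban1985Variational], [13] = [Balaban1985BackgroundPropagators], [12] = [Balaban1985Averaging],
[10]/[11] = [Balaban1984PropagatorsI]/[Balaban1984PropagatorsII].

CITATION HEADER (lean-in-tree rule).  P6 CARVING FAN block 38 (cell `lit-balaban`, `carve/BLOCKS-31-40.md` v1.1 § Block 38,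
rules `carve/CARVE-RULES.md`, lead RULING #7 2026-08-28): [B16] pp. 355–366.  KEY item (consumer)
`stmt-QuantumFields-20542` (K1⁷, DAG lane n13 [B16]); also-feeds `stmt-QuantumFields-20544`.

IN TREE = CITED, NEVER RESTATED.  All 56 SKELETON rows of the block have a decl of record and are cited here BY NAME
(row → decl): Thm 1 `B16.Thm1Printed`; (0.1) `B16.UVBound01` ∕ `B16.uvBound01PerRun_of_cor3` ∕ `B16.EndStatementBPrinted`;
*"Theorem 2 of [I]"* `B16.sect2_unconditional_of_Thm2`; p. 356 scope `Missing.hasSubseqContinuumLimit_of_bounded`;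
`A(ζ, U)` `B16Sect1Wilson.wilsonLoc`; (1.1) `B16Sect1Assembly.den11` ∕ `term11`; (1.2) `B16Sect1Assembly.int12` ∕ `Eq12`,
p. 357 V-term `B16Sect1Statements.Ineq12V` ∕ `B16Txt357ThirdOrderU1.ineq12V_U1`; (1.3) `B15DeterminingSets.IsMinimizer` ∕
`B16Sect1Backgrounds.Sect1Data.IsMin13`; (1.4) `B16Eq14.proj_J0_eq_zero_of_eq14` ∕ `inner_H_J0_eq_zero_of_eq14`; (1.5)
`B16Eq14.eq15`; (1.6) `B16Sect1Wilson.Ineq16` ∕ `ineq16_arith` ∕ `B16Sect1SmallFactors.ineq16_rhs_small` ∕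
`B16Ineq16From190`; (1.7) `B16Sect1Wilson.Ineq17` ∕ `B16Ineq17Assembly.ineq17_of_inputs` (its three printed steps:
`B16Ineq17ZetaError`, `B16Ineq17MinimizerError` — *«a quadratic form bounded by O(exp(−R_k))»* —, Sect. F [15] letter
`B16Ineq17MinimizerError.firstOrderError_le_letter`) ∕ `B16Ineq17BoxTorus`; (1.8) `B16Sect1Wilson.Ineq18` ∕ `ineq18_cube` ∕
`B16Eq18Proof` ∕ the p. 358 aside *«(100M)³ in the x₁-axial gauge»* `B16Ineq18AxialGauge.ineq18_axial_printed`; (1.9)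
`B16Sect1Wilson.Ineq19` ∕ `ineq19_of_17_18` ∕ `B16Sect1SmallFactors.ineq19_of_17_18_small` ∕ `B16Ineq17BoxTorus.ineq19_chart_lattice`;
p. 358 lower bound `B16Sect1Statements.DenomLower358` ∕ `B16Ineq111Gaussian.Inputs.denomLower358_int12`; (1.10)
`B16Sect1Wilson.Ek110` ∕ `I110` ∕ `eq110`; (1.11) `B16Sect1Wilson.Ineq111` ∕ `ineq111_arith` ∕
`B16Ineq111Gaussian.Inputs.ineq111_I110`; Prop. 1 [IV] pp. 358–359 `B16Prop1IVAssembly.prop1IV_model` ∕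
`B16Prop1IVFromProp4` ∕ `B16Prop1IVAnalytic` ∕ `B16Prop1IVInverseC`, (1.12) `B16Eq112` ∕
`B16Prop1IVFromProp4.forall_gauge_inner_eq_zero_iff`, (1.13) `B16Prop1IVAssembly.exists_inverse_of_pos`, *«twice a bound»*
`B16Sect1Kernels.fixedPoint_twice_bound`; (1.14) `B16Sect1Wilson.eq114`; (1.15) `eq115`; (1.16)
`B16Sect1Backgrounds.Sect1Data.cfgPP` ∕ `Repr116` ∕ `Repro116` ∕ `arg116`; (1.17) `B16Eq117Expansion.Sect1Data.Eq117` ∕ `Eq117'` ∕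
`eq115_expanded`, its «suppresses all powers» clause `B16Suppression`; (1.18) `B16Sect1Wilson.eq118`; (1.19)
`B16Sect1Backgrounds.Sect1Data.Eq119a` ∕ `Repr119` ∕ `IsRepr`, *«|B| < g_k⁻¹δ′_k by (1.82) [IV]»* `B16Eq119ChartDictionary`;
(1.20) `B16Sect1WilsonTerms.Sect1Data.Eq120`, its third-order term `B16Sect1Statements.Ineq120V` ∕ `ineq120V_arith` ∕
`B16Sect1SmallFactors.ineq120V_small`, its small quadratic terms `Ineq120Q` ∕ `ineq120Q_arith` ∕ `ineq120Q_small`, *«N ≦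
R_k»* `B16Sect1Kernels.NWindowUpper`; (1.21) `B16ComponentForm.blockForm`; (1.22) `B16Sect1Backgrounds.Sect1Data.detB1loc`
∕ `Repr122` ∕ `Repro122` ∕ `arg122`; (1.23) `B16Sect1Statements.Ineq123` ∕ `rhs123` ∕ `fieldBound123_chain` ∕
`B16Ineq123From190.ineq123_of_ineq190`; (1.24) `B16Sect1WilsonTerms.Sect1Data.Eq124`, second term
`B16Sect1Statements.Ineq124snd` ∕ `vol124` ∕ `B16Ineq124Absorption` ∕ `B16Sect1SmallFactors.ineq124snd_const_small`; (1.25)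
`B16Sect1Backgrounds.Sect1Data.eq125` ∕ `B12CriticalPoint23.iter_gaugeAct`; (1.26) `B16Eq117Expansion.Hbd126` ∕ `RW126`;
(1.27) `B16Sect1Statements.Ineq127` ∕ `B16Ineq127FromWalks.ineq127_of_rw126`; (1.28) `Ineq128simple` ∕ `Ineq128first` ∕
`B16Ineq128FirstOrder.ineq128first_of_simple` ∕ `B16Sect1SmallFactors.ineq128first_small`; (1.29)
`B16Sect1WilsonTerms.Eq129`, its two layers `B16Sect1Statements.Ineq129a` ∕ `Ineq129b` ∕ `ineq129b_arith` ∕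
`B16Sect1SmallFactors.ineq129a_small` ∕ `ineq129b_window`, the N-window `B16Sect1Kernels.NWindowLower` ∕
`nWindowLower_of_log` ∕ `NuCondition363` ∕ `NWindow` ∕ `B16Sect1SmallFactors.window_core`; (1.30) `B16Sect1Wilson.eq130`;
(1.31) `B16Sect1Wilson.Ineq131` ∕ `wilsonLoc_nonneg` ∕ `wilsonLoc_le_card_mul` ∕ `B16Ineq131Assembly.ineq131_of_inputs` ∕
`B16Sect1SmallFactors.ineq131_window`; (1.32) `B16Sect1WilsonTerms.Eq132` ∕ `O132`; (1.33) `B16Sect1Wilson.detSet133` ∕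
`B16Eq133NewDeterminingSet.detSetK133`; (1.34) `B16Sect1Wilson.glue134` ∕ `B16Sect1Backgrounds.Sect1Data.data134`; (1.35)
`cfgK135` ∕ `B16Eq133NewDeterminingSet.with133`; p. 365 coupling function `B16Sect1Wilson.couplingGlue` ∕
`wilson_recombine_p365`; (1.36) `B16Sect1Backgrounds.Sect1Data.detPPZm3` ∕ `Repr136` ∕ `arg136`; (1.37)
`B16Sect1WilsonTerms.Eq137`; p. 366 `B16Sect1Statements.CouplingDiff366` ∕ `couplingDiff366_le_Rk` ∕ `Ineq366` ∕
`Ineq366final` ∕ `B16Lem366Coupling.couplingDiff366_of_rg` ∕ `B16Sect1SmallFactors.ineq366_mid_small`; (1.38)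
`B16Sect1AnalyticExt.ExtData` ∕ `Eq138` ∕ `Fact138M` ∕ `B16Eq143TildeAverage.eq138_slice`; (1.39)
`B16Sect1AnalyticExt.ExtData.fun139` ∕ `Def139`; row B16.§1 (the conclusion of 𝐑, pp. 356–384) `B16.thm1_of_steps` ∕ `B16.InductionStep`; p. 355 `T4Continuum.BetaPertHyp`.  The pp. 378–390 displays are the
sibling bundle `B16Sect1DisplaysPrinted.Sect1DisplaysPrinted` (NOT this block).

WHAT THIS FILE DECLARES (hypothesis-form `Prop`s with the verbatim sentence and locator; definitions with bodies;
kernel-checked bookkeeping; NOTHING of the paper is asserted, no proof of any printed bound is claimed).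
* §1 the residual printed statements of pp. 357–366 that had NO declaration of record (each appears in the tree at most
  as a docstring quotation or as a hypothesis binder of a theorem): p. 357 *«Λ is contained in a cube of the size 100M»*
  (`LambdaCube357Printed`, the site-count reading `hvol` of the tree's arithmetic); p. 357 Sect. F [15] representation
  bound (`RepF357Printed`); p. 361 the count `|𝐁₀| ≦ (100MR_k)^dN²` inside the third-order chain (`CardB0Le361Printed`,
  the `hB₀` of the tree's arithmetic); p. 359 *«localized in Λ as a function of the field U″_k»* (`DependsOnlyOn`,
  `Localized114Printed`); p. 360 ∕ p. 361–362 ∕ p. 365 the bounds `44d²ε_k`, `11d²ε_h`, `44d²ε_k` on the chart arguments of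
  (1.16), (1.22), (1.36) with their support layers (`Arg116Bound360Printed`, `Arg122Bound362Printed`,
  `Arg136Bound365Printed`, over the tree's `Sect1Data`); p. 360 *«V″ on the domain (Ω″~²_{h+1})ᶜ is equal to the old
  field V»* (`VppEqOld360Printed`); p. 361 the regularity of `U⁰_{k,Z}` with constant `O(1)B₃²B₅M⁵ε_k` (`Reg361Printed`,
  over `B11.VarProblem.InU` = conditions (2) [15]); p. 362 *«Similar, or better, bounds hold for the remaining two terms»*
  (`Ineq124Rest362Printed`); p. 363 the locality clause of (1.28) (`Dep128Printed`); p. 363 the second ζ-split term with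
  its factor `exp(−δ8MR_k)` (`ZetaSplitSecond363Printed`); p. 364 *«(1/(g″_k(·))²) − 1/g_k² is bounded by O(1)(k − j) on
  Ω″_j∖Ω″_{j+1}»* (`CouplingDiff364Printed`, PROVED for the flow values from the RG equations by
  `couplingDiff364_of_rg`); p. 364 *«therefore the above term is equal to 0»* (PROVED as (1.4) applied,
  `firstTerm364_eq_zero`); p. 366 *«|B̃′| < O(1)α_{1,k}»* (`BtildeBound366Printed`).
* §2 the letters `Consts`, the step values `StepValues` (DATA), and the bundle `BoundsAt D k v c` = the conjunction BY
  NAME of the section's real-letter printed bounds at one step of one run (28 conjuncts, all existing `Prop`s of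
  `B16Sect1Wilson` ∕ `B16Sect1Statements` ∕ `B16Sect1Kernels` plus the §1 real-letter slots), and `Hyp C X c` = the same
  for a `B16.Construction` in the pattern of `B16.Thm1Printed` ∕ `B16Sect1DisplaysPrinted.Sect1DisplaysPrinted`
  (∃ γ > 0, ∀ runs with couplings in ]0, γ], ∀ k ≤ K), so that a node prover takes `(h : Hyp C X c)`.
* §3 bookkeeping PROVED by name (no analytic content): the projections a consumer cites, and four knits showing that the
  bundle's conjuncts feed the tree's arithmetic theorems as their located hypotheses (`ineq111_arith`, `denomLower358_M4`,
  `ineq120V_arith`, `couplingDiff366_le_Rk`).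
NOT CONJOINED INTO `Hyp` (and why): Theorem 1 ∕ (0.1) ∕ (B) — they are the CONSUMER'S CONCLUSION (`B16.EndStatementBPrinted`
is the head of `stmt-QuantumFields-20542`), so a bundle containing them would smuggle it; the object-level identities
(1.2), (1.16)–(1.17), (1.19)–(1.20), (1.22), (1.24), (1.29), (1.32), (1.36)–(1.39) — typed in the tree over `Sect1Data` ∕
`ExtData` ∕ measure carriers (cited above), which a node prover at K1⁷ does not hold; the §1 slots over `Sect1Data` ∕
`B11.VarProblem` for the same reason (M-level consumers take them by name).  HONEST SCOPE.  With carriers chosen freely every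
conjunct of `BoundsAt` is inhabited by trivial data (values `0`, empty point types); the bundle earns its keep only when `X`
is read off Bałaban's own objects.  Rung (B) context only: NOT the continuum limit, NOT a mass gap.  No `sorry`, no axiom, no
instance, no notation.
-/

namespace Literature.MathematicalPhysics.QuantumFieldTheory.Balaban1983to89.B16Carve38Thm1LocalizationHyp

open Literature.MathematicalPhysics.QuantumFieldTheory.Balaban1983to89
open B16Sect1Wilson B16Sect1Statements B16Sect1Kernels B16Sect1Backgrounds B15DeterminingSets
open scoped RealInnerProductSpace

noncomputable section

/-! ## §0 Two printed letter conventions used below -/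

/-- The profile power `(log g⁻²)^p` of [III] (2.2)∕(2.4) and [IV] p. 182 in THIS paper's convention `ε_k = g_kA₀p₀(g_k)`,
`δ′_k = g_kA₁p₁(g_k)` with `p₀(g) = (log g⁻²)^{p₀}`, `p₁(g) = (log g⁻²)^{p₁}` (p. 357 (1.6): *«(1/g_k)B₃M₀A₀p₀(g_k) … 3ε_k|Λ|
< 3B₃M₀A₀²p₀²(g_k) …»* forces `A₀` outside `p₀(·)`); equals `p0Profile 1 p g` of `…Balaban1983to89.Setup`
(`logPow_eq_p0Profile`). [cite: Balaban1989LargeFieldII, (1.6) p.357] -/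
def logPow (p : ℕ) (g : ℝ) : ℝ := (Real.log (g ^ 2)⁻¹) ^ p

/-- `logPow p g = p0Profile 1 p g` (the tree's profile with unit prefactor). [cite: Balaban1988Convergent, (1.1) p.246] -/
theorem logPow_eq_p0Profile (p : ℕ) (g : ℝ) : logPow p g = p0Profile 1 p g := by
  simp [logPow, p0Profile]

/-- The scaled length `L^jη` with `η = L^{−k}` (p. 362 (1.23) *«L^jη|𝐇_{𝐁₁}|»*, p. 363 *«(L^hη)^{d−1}»*), as the real
number `L^j·(L^k)⁻¹`. [cite: Balaban1989LargeFieldII, (1.23) p.362] -/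
def scaleLen (L : ℝ) (k j : ℕ) : ℝ := L ^ j * (L ^ k)⁻¹

/-- At the top scale the scaled length `L^kη` is `1` (`L ≠ 0`; `η = L^{−k}`). [cite: Balaban1989LargeFieldII, (1.23) p.362] -/
theorem scaleLen_self {L : ℝ} (hL : L ≠ 0) (k : ℕ) : scaleLen L k k = 1 := by
  simp [scaleLen, mul_inv_cancel₀ (pow_ne_zero k hL)]

/-! ## §1 Residual printed statements of pp. 357–366 (no declaration of record before this file) -/

/-! ### §1a Real-letter clauses -/

/-- **p. 357 [PDF 3], after (1.6)**, verbatim: *«where we have used the fact that Λ is contained in a cube of the size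
100M.»* — READ, as every arithmetic theorem of the tree consumes it (`B16Sect1Wilson.ineq16_arith` ∕ `ineq111_arith`,
`B16Sect1Statements.denomLower358_M4`: hypothesis `hvol : volΛ ≤ (100·M)^4`), as the site-count bound `|Λ| ≦ (100M)^d`
(`d = 4` in print; `volΛ` = `|Λ|`).  A hypothesis slot; the geometric containment itself is [IV] Sect. 1's construction
of `Λ`. [cite: Balaban1989LargeFieldII, p.357 (after (1.6))] -/
def LambdaCube357Printed (volΛ M : ℝ) (d : ℕ) : Prop :=
  volΛ ≤ (100 * M) ^ d

/-- **p. 361 [PDF 7], inside the third-order chain of (1.20)**, verbatim: *«Thus the last term is bounded by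
O(1)|𝐁₀|δ′_k³ ≦ O(1)(100MR_k)^dN²δ′_k³ ≦ g_k³O(1)M^dR_k^{d+2}A₁³p₁³(g_k)»* — the COUNT `|𝐁₀| ≦ (100MR_k)^dN²` of the bond
variables of the multi-scale set `𝐁₀` ([IV] Sect. 1) that the first `≦` uses; the located hypothesis `hB₀` of
`B16Sect1Statements.ineq120V_arith` ∕ `ineq120Q_arith` ∕ `sigmaQuad379_arith`, here as its own slot (`cardB₀` = `|𝐁₀|`).
[cite: Balaban1989LargeFieldII, (1.20) p.361] -/
def CardB0Le361Printed (cardB₀ M Rk : ℝ) (N d : ℕ) : Prop :=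
  cardB₀ ≤ (100 * M * Rk) ^ d * (N : ℝ) ^ 2

/-- **p. 357 [PDF 3], the Sect. F [15] representation of `U₀`**, verbatim: *«At first, we apply the construction of
Sect. F [15] to the configuration U₀, and doing a proper gauge transformation we represent it on the domain Z as exp iξA₀,
with A₀ satisfying the bound |A₀|, |∇^ηA₀| < O(1)M⁶R_kε_k.»* — over the two sup-sizes `nA₀` = `|A₀|`, `nGradA₀` =
`|∇^ηA₀|` on `Z`, the `O(1)` an explicit `C`.  (In the tree this bound is the letter `hm : m ≤ K_F·M⁶R_kε_k` of
`B16Ineq17MinimizerError.firstOrderError_le_letter`; the general theorem is [15] Sect. F.) [cite: Balaban1989LargeFieldII, p.357 (before (1.7))] -/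
def RepF357Printed (nA₀ nGradA₀ C M Rk εk : ℝ) : Prop :=
  nA₀ < C * M ^ 6 * Rk * εk ∧ nGradA₀ < C * M ^ 6 * Rk * εk

/-- **p. 362 [PDF 8], after the bound on the second term of (1.24)**, verbatim: *«and the number multiplying g_k² can be
made arbitrarily small for g_k small enough. Similar, or better, bounds hold for the remaining two terms.»* — the remaining
two terms of (1.24) (`½⟨𝐇_{𝐁₁}, Δ(ζ)𝐇_{𝐁₁}⟩` and `V₀(ζ, 𝐇_{𝐁₁})`, values `T₃`, `T₄`) each admit a bound of the printed final
shape `g_k²O(1)A₀²B₃²B₅M^{d+5}R_k^{d+1}p₀²(g_k)exp(−R_k)` of `B16Sect1Statements.Ineq124snd`, each with its own `O(1)`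
(`C₃`, `C₄`). [cite: Balaban1989LargeFieldII, (1.24) p.362] -/
def Ineq124Rest362Printed (T₃ T₄ gk C₃ C₄ A₀ B₃ B₅ M Rk p₀g : ℝ) (d : ℕ) : Prop :=
  |T₃| ≤ gk ^ 2 * C₃ * A₀ ^ 2 * B₃ ^ 2 * B₅ * M ^ (d + 5) * Rk ^ (d + 1) * p₀g ^ 2 * Real.exp (-Rk) ∧
    |T₄| ≤ gk ^ 2 * C₄ * A₀ ^ 2 * B₃ ^ 2 * B₅ * M ^ (d + 5) * Rk ^ (d + 1) * p₀g ^ 2 * Real.exp (-Rk)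

/-- **p. 363 [PDF 9], the second term of the `ζ`-splitting of the first term of (1.29)**, verbatim: *«We write it as a
sum of two terms corresponding to the decomposition ζ = (1 − ζ₁) − (1 − ζ₀)(1 − ζ₁). For the second term the support of the
function (1 − ζ₀)(1 − ζ₁) = 1 − ζ₀ is sufficiently far from the support of the field B. The distance is larger than 8MR_k,
hence a bound for this term has the additional exponential factor exp(−δ8MR_k), and the term is small.»* — on the value
`T` of that term: a bound of the form *usual factor × exp(−δ8MR_k)*; print does not pin the factor, so it is the free
letter `F` (a consumer instantiates it with the (1.28)-type bound `B16Sect1Statements.Ineq128simple` of the undecomposed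
term; with `F` free the slot alone carries no size information). [cite: Balaban1989LargeFieldII, (1.29) p.363] -/
def ZetaSplitSecond363Printed (T F δ M Rk : ℝ) : Prop :=
  |T| ≤ F * Real.exp (-(δ * 8 * M * Rk))

/-- **p. 364 [PDF 10], the multi-scale coupling difference**, verbatim: *«The remaining terms are small by the same
reason as in the case of the expansion (1.17). We have to notice only that (1/(g″_k(·))²) − 1/g_k² is bounded by
O(1)(k − j) on Ω″_j∖Ω″_{j+1}, and the exponential decay of H″_{k,Z} suppresses this bound.»* — at one plaquette of
`Ω″_j∖Ω″_{j+1}`, with `c` the value of the coupling function `1/(g″_k(·))²` there and the `O(1)` an explicit `C`: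
`|c − 1/g_k²| ≤ C·(k − j)`.  (Companion of the p. 366 clause `B16Sect1Statements.CouplingDiff366` — `O(N)` on `supp ζ`.)
[cite: Balaban1989LargeFieldII, p.364 (after (1.32))] -/
def CouplingDiff364Printed (c gk C : ℝ) (k j : ℕ) : Prop :=
  |c - 1 / gk ^ 2| ≤ C * ((k : ℝ) - j)

/-- The p. 364 clause PROVED for the values the coupling function takes: on `Ω″_j∖Ω″_{j+1}` the function `1/(g″_k(·))²`
of [IV] (1.27) equals `1/g_j²`, and the RG equations (0.20) [I] (`Step.RGEq`) with couplings in `]0, γ]`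
(`Step.InInterval`) and `|β_i(x)| ≦ β′` there ([I] p. 264) give `|1/g_j² − 1/g_k²| ≦ β′(k − j)` — the tree's
`B16Lem366Coupling.abs_inv_sq_sub_inv_sq_le`, re-read in this slot's shape with `O(1) = β′`.
[cite: Balaban1989LargeFieldII, p.364 (after (1.32))] -/
theorem couplingDiff364_of_rg {K : ℕ} {β : ℕ → ℝ → ℝ} {g : ℕ → ℝ} {β' γ : ℝ} (h : Step.RGEq K β g)
    (hI : Step.InInterval γ K g) (hB : ∀ i x, 0 < x → x ≤ γ → |β i x| ≤ β') {j k : ℕ} (hjk : j ≤ k) (hk : k ≤ K) :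
    CouplingDiff364Printed (1 / (g j) ^ 2) (g k) β' k j :=
  B16Lem366Coupling.abs_inv_sq_sub_inv_sq_le h hI hB hjk hk

/-- **p. 366 [PDF 12], the chart field of the complex average**, verbatim: *«By the definition we have 𝐔 = U′U, where U is
a G-valued configuration satisfying the regularity condition |∂U − 1| < α_{0,k}η², and U′ = exp iηA′, where A′ is a
𝔤ᶜ-valued function satisfying the bounds |A′|, |∇^η_U A′| < α_{1,k}. We write M^k(𝐔) = M̃^k(U′)M^k(U), and M̃^k(U′) =
exp iQ̃_k(ηA′) = exp iB̃′, |B̃′| < O(1)α_{1,k}.»* — the last bound, over the size `nBt` = `|B̃′|` at a bond, the `O(1)` an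
explicit `C` (the factorisation itself is `B16Sect1AnalyticExt.ExtData.Fact138M`; the bound is [12] Prop. 6 (164), not
asserted here). [cite: Balaban1989LargeFieldII, p.366 (before (1.38))] -/
def BtildeBound366Printed (nBt C α₁ : ℝ) : Prop :=
  nBt < C * α₁

/-- **p. 361 [PDF 7], the regularity of the localized background**, verbatim: *«Using the estimate (1.80) [IV] and
Theorem 1 [15] we see that U⁰_{k,Z} satisfies the usual regularity conditions (2) [15], for the sequence {Ω″_j} restricted
to Ω^c_k ∩ Ω″~_{h+1}, with the constant O(1)B₃²B₅M⁵ε_k instead of ε₀.»* — over the tree's abstract carrier of [15]'s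
variational problem `B11.VarProblem` (whose `InU ε U` IS *"U ∈ 𝔘_k({Ω_j}, ε), conditions (2)"*), instantiated by a
consumer with the geometric datum `{Ω″_j ∩ Ω^c_k ∩ Ω″~_{h+1}}` and `U` = `U⁰_{k,Z}`; the `O(1)` an explicit `C`.
[cite: Balaban1989LargeFieldII, p.361 (after (1.20)); Balaban1985Variational, (2) p.278] -/
def Reg361Printed (VP : B11.VarProblem) (U : VP.Cfg) (C B₃ B₅ M εk : ℝ) : Prop :=
  VP.InU (C * B₃ ^ 2 * B₅ * M ^ 5 * εk) U

/-! ### §1b Locality clauses over the fine-lattice carrier of `…Balaban1983to89.Setup` -/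

section Locality

/-- *"T depends on U restricted to X"* ∕ *"T is localized in X as a function of the field U"* for a quantity `T(U)` of
fine-lattice configurations: configurations that agree on the bonds meeting `X` (`B16Sect1Backgrounds.EqOn0`, the tree's
READING (a) of restriction to a region) give the same value.  A definition with a body (the locality notion of p. 359 l. 33,
p. 360 l. 19, p. 363 l. 6 had no decl). [cite: Balaban1989LargeFieldII, p.363 (after (1.28))] -/
def DependsOnlyOn {P : Params} {G : Type*} [GaugeGroup G] {α : Type*} (X : Set (Site P 0))
    (T : GaugeField P 0 G → α) : Prop :=
  ∀ U U' : GaugeField P 0 G, EqOn0 X U U' → T U = T U'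

/-- A constant quantity is localized in any region (bookkeeping for the locality clauses of pp. 359, 363). [cite: Balaban1989LargeFieldII, p.363 (after (1.28))] -/
theorem dependsOnlyOn_const {P : Params} {G : Type*} [GaugeGroup G] {α : Type*} (X : Set (Site P 0)) (a : α) :
    DependsOnlyOn X (fun _ : GaugeField P 0 G => a) :=
  fun _ _ _ => rfl

/-- Locality is monotone in the region: localized in `X ⊆ Y` ⇒ localized in `Y` (bonds meeting `X` meet `Y`) — the step
from *«restricted to the domain Z ∩ Ω″~_{h+1}»* to *«or rather to the neighborhood of this domain»* on p. 363. [cite: Balaban1989LargeFieldII, p.363 (after (1.28))] -/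
theorem DependsOnlyOn.mono {P : Params} {G : Type*} [GaugeGroup G] {α : Type*} {X Y : Set (Site P 0)}
    {T : GaugeField P 0 G → α} (h : DependsOnlyOn X T) (hXY : X ⊆ Y) : DependsOnlyOn Y T := by
  intro U U' hU
  refine h U U' fun b hb => hU b ?_
  have hsub : bondsOf (pts 0 X) ⊆ bondsOf (pts 0 Y) := by
    intro b' hb'
    simp only [bondsOf, pts, Set.mem_setOf_eq, Set.mem_preimage] at hb' ⊢
    exact hb'.imp (fun h1 => hXY h1) (fun h2 => hXY h2)
  exact hsub hb

/-- Post-composition preserves locality (e.g. `U ↦ |T(U)|`, `U ↦ −T(U)/g_k²`; bookkeeping for the locality clauses of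
pp. 359, 363). [cite: Balaban1989LargeFieldII, p.363 (after (1.28))] -/
theorem DependsOnlyOn.comp {P : Params} {G : Type*} [GaugeGroup G] {α β : Type*} {X : Set (Site P 0)}
    {T : GaugeField P 0 G → α} (h : DependsOnlyOn X T) (f : α → β) : DependsOnlyOn X (fun U => f (T U)) :=
  fun U U' hU => congrArg f (h U U' hU)

/-- **p. 359 [PDF 5], after (1.14)**, verbatim: *«A(1/(g″_k(·))², U″_k) = (1/g_k²)A(U″_k) + A(1/(g″_k(·))² − 1/g_k², U″_k).
(1.14) The second term on the right-hand side is localized in Λ as a function of the field U″_k. We leave it in this form.»*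
— for the tree's localized Wilson action `B16Sect1Wilson.wilsonLoc` with the weight `c − 1/g_k²` (`c` = the coupling
function `1/(g″_k(·))²` on fine plaquettes) and gauge group `G`: the functional `U ↦ A(c − 1/g_k², U)` is
`DependsOnlyOn Λ`. [cite: Balaban1989LargeFieldII, (1.14) p.359] -/
def Localized114Printed {P : Params} (G : Type*) [GaugeGroup G] (c : Plaq P 0 → ℝ) (gk : ℝ) (Λ : Set (Site P 0)) :
    Prop :=
  DependsOnlyOn Λ (fun U : GaugeField P 0 G => wilsonLoc (fun p => c p - 1 / gk ^ 2) U)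

end Locality

/-! ### §1c Clauses over the Sect. 1 data carrier `B16Sect1Backgrounds.Sect1Data` -/

section OverSect1Data

variable {P : Params} {G : Type*} [GaugeGroup G] {av : ∀ i, Averaging P i G} {𝔤 : Type*} [AddCommGroup 𝔤] [Module ℝ 𝔤]

omit [Module ℝ 𝔤] in
/-- Restriction of a multi-scale chart field to a region is idempotent — the form in which *"has a support in …"* is
recorded below (`msRestrict X A = A`; the restrictions `↾_{Z∖Z^{∼−1}}` of (1.16)). [cite: Balaban1989LargeFieldII, (1.16) p.360] -/
theorem msRestrict_idem (X : Set (Site P 0)) (A : MSVecField P 𝔤) : msRestrict X (msRestrict X A) = msRestrict X A := by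
  funext i b
  by_cases hb : b ∈ bondsOf (pts i X) <;> simp [msRestrict, hb]

/-- **p. 360 [PDF 6], after (1.16)**, verbatim: *«The argument of the function 𝐇″_{k,Z} has a support in a layer of width
2M₁ at the boundary ∂Z, and it can be bounded by 44d²ε_k, as it follows from the restrictions given by the characteristic
functions χ_k.»* — over the tree's datum: the argument IS `Sect1Data.arg116 = (1/i) log[M˙(U″_k)(M˙(Q_k^{s*}V_k))⁻¹]↾_{Z∖Z^{∼−1}}`
(its support clause is built into the restriction `↾_{Z∖Z^{∼−1}}`, `arg116_support`); the printed BOUND, for a size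
function `nrm` on `𝔤` (print's `|·|`), at every scale and bond: `|arg116| ≦ 44d²ε_k`. [cite: Balaban1989LargeFieldII, (1.16) p.360] -/
def Arg116Bound360Printed (D : Sect1Data P G av 𝔤) (nrm : 𝔤 → ℝ) (d : ℕ) (εk : ℝ) : Prop :=
  ∀ (i : ℕ) (b : PBond P i), nrm (D.arg116 i b) ≤ 44 * (d : ℝ) ^ 2 * εk

/-- The support half of the p. 360 sentence holds by construction of the tree's datum: `arg116` is restricted to the layer
`Z∖Z^{∼−1}` (the *"layer of width 2M₁ at the boundary ∂Z"* in `Sect1Data`'s regions). PROVED. [cite: Balaban1989LargeFieldII, (1.16) p.360] -/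
theorem arg116_support (D : Sect1Data P G av 𝔤) : msRestrict (D.Z \ D.Zm1) D.arg116 = D.arg116 := by
  unfold Sect1Data.arg116
  exact msRestrict_idem _ _

/-- **pp. 361–362 [PDF 7–8], after (1.22)**, verbatim: *«The argument of the function 𝐇_{𝐁₁} has a support in the boundary
layer of the width 2M₁ (in the L^{−h}-scale), at the boundary ∂Ω″~²_{h+1}. … By the usual reasoning the field in the
argument of the function 𝐇_{𝐁₁} can be bounded by 11d²ε_h ≦ 11d²(1 + β₀)²N^{β₀}ε_k ≦ 11d²(1 + β₀)²R_k^{β₀}ε_k,»* — over the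
tree's datum `Sect1Data.arg122 = (1/i) log[M˙(U⁰_{k,Z})(M˙(U₀^{(AL)}))⁻¹]` (no restriction built in): support in an explicit
`layer ⊂ T_η` (the printed boundary layer, supplied by the consumer) and the first printed bound `11d²ε_h` at every scale and
bond (the chain to `R_k^{β₀}ε_k` is PROVED in the tree: `B16Sect1Statements.fieldBound123_chain`).
[cite: Balaban1989LargeFieldII, (1.22)–(1.23) pp.361–362] -/
def Arg122Bound362Printed (D : Sect1Data P G av 𝔤) (layer : Set (Site P 0)) (nrm : 𝔤 → ℝ) (d : ℕ) (εh : ℝ) : Prop :=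
  msRestrict layer D.arg122 = D.arg122 ∧ ∀ (i : ℕ) (b : PBond P i), nrm (D.arg122 i b) ≤ 11 * (d : ℝ) ^ 2 * εh

/-- **p. 365 [PDF 11], after (1.36)**, verbatim: *«The argument of the 𝐇-function above has a support in the boundary
layer of the width 2M₁ at the boundary ∂Z^{∼−3}, and it is bounded by 44d²ε_k.»* — over the tree's datum
`Sect1Data.arg136 = −(1/i) log[M˙(U_k)(M˙(Q_k^{s*}V_k))⁻¹]` (no restriction built in): support in an explicit `layer`
(the printed one; in `Sect1Data`'s regions `Z^{∼−3} ∖ (Z^{∼−3})^{∼−2}` = `D.Zm3 \ D.Zm3m2` is the intended instance) and the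
bound `44d²ε_k`. [cite: Balaban1989LargeFieldII, (1.36) p.365] -/
def Arg136Bound365Printed (D : Sect1Data P G av 𝔤) (layer : Set (Site P 0)) (nrm : 𝔤 → ℝ) (d : ℕ) (εk : ℝ) : Prop :=
  msRestrict layer D.arg136 = D.arg136 ∧ ∀ (i : ℕ) (b : PBond P i), nrm (D.arg136 i b) ≤ 44 * (d : ℝ) ^ 2 * εk

/-- **p. 360 [PDF 6], after (1.19)**, verbatim: *«Notice that the field V″ on the domain (Ω″~²_{h+1})ᶜ is equal to the old
field V. We denote the new background field by U⁰_{k,Z}.»* — over the tree's datum (`D.Vpp` = `V″` of [IV] (1.81), `D.V` =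
the original multi-scale field, `D.ΩppT2` = `Ω″~²_{h+1}`; region membership of bonds in the tree's READING (a),
`B15DeterminingSets.splice`): replacing `V″` by `V` off `Ω″~²_{h+1}` changes nothing. [cite: Balaban1989LargeFieldII, (1.19) p.360] -/
def VppEqOld360Printed (D : Sect1Data P G av 𝔤) : Prop :=
  splice D.ΩppT2 D.Vpp D.V = D.Vpp

/-- The pointwise form of `VppEqOld360Printed`: at every scale `j`, on every bond NOT meeting `(Ω″~²_{h+1})^{(j)}`, `V_j =
V″_j`. PROVED (unfolding `splice`). [cite: Balaban1989LargeFieldII, (1.19) p.360] -/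
theorem vppEqOld360_iff (D : Sect1Data P G av 𝔤) :
    VppEqOld360Printed D ↔ ∀ (j : ℕ) (b : PBond P j), b ∉ bondsOf (pts j D.ΩppT2) → D.V j b = D.Vpp j b := by
  constructor
  · intro h j b hb
    have h' : splice D.ΩppT2 D.Vpp D.V = D.Vpp := h
    have := congrFun (congrFun h' j) b
    simpa [splice, spliceAt, hb] using this
  · intro h
    show splice _ _ _ = _
    funext j b
    by_cases hb : b ∈ bondsOf (pts j D.ΩppT2)
    · simp [splice, spliceAt, hb]
    · simp [splice, spliceAt, hb, h j b hb]

/-- **p. 363 [PDF 9], after (1.28)**, verbatim: *«This expression depends on the background field U⁰_{k,Z} restricted to the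
domain Z ∩ Ω″~_{h+1} (or rather to the neighborhood of this domain obtained by adding the boundary layer of the width
5M₁L^{−N+1} at the boundary ∂Ω″~_{h+1}), and the dependence is analytic.»* — the LOCALITY half (analyticity is not modelled at
this level, as everywhere in the block): for the value `T128(U)` of (1.28) as a function of the background and a
neighborhood `nbhd` of `Z ∩ Ω″~_{h+1}` (`D.Z ∩ D.ΩppT`; the printed one adds the `5M₁L^{−N+1}`-layer),
`Z ∩ Ω″~_{h+1} ⊆ nbhd` and `T128` is `DependsOnlyOn nbhd`. [cite: Balaban1989LargeFieldII, (1.28) p.363] -/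
def Dep128Printed (D : Sect1Data P G av 𝔤) (nbhd : Set (Site P 0)) (T128 : GaugeField P 0 G → ℝ) : Prop :=
  D.Z ∩ D.ΩppT ⊆ nbhd ∧ DependsOnlyOn nbhd T128

end OverSect1Data

/-! ### §1d p. 364: the first term vanishes by (1.4) — PROVED in the vocabulary of `B16Eq14` -/

section FirstTerm364

variable {F D D' : Type*} [NormedAddCommGroup F] [InnerProductSpace ℝ F] [AddCommGroup D] [Module ℝ D]
  [AddCommGroup D'] [Module ℝ D']

/-- **pp. 363–364 [PDF 9–10]**, verbatim: *«The first term is equal to g_k⟨(1 − ζ₁)H″_{1,k,X₀}R(ū₀⁻¹)B, J₀⟩, and the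
function multiplying J₀ satisfies the condition Q_{𝐁_k(Z)}(1 − ζ₁)H″_{1,k,X₀}R(ū₀⁻¹)B = 0 on Z∖Λ. It follows from the
definition of the function H″_{1,k,X₀}, and from the fact that the support of the field B is contained in Λ. This condition
is exactly the same as the condition for δA in (1.4), therefore the above term is equal to 0.»* — PROVED as (1.4) applied:
with `B16Eq14`'s carriers (`Q` = `Q_{𝐁_k(Z)}`, `R` = restriction to `Z∖Λ`, `h14` = (1.4)) and `f` = the function multiplying
`J₀` satisfying the displayed condition `hf`, the first term `g_k⟨f, J₀⟩` is `0`.  (That `f` satisfies `hf` — *"It follows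
from the definition of the function H″_{1,k,X₀} …"* — is the located input, quoted at its binder.)
[cite: Balaban1989LargeFieldII, p.364 (before (1.30))] -/
theorem firstTerm364_eq_zero (Q : F →ₗ[ℝ] D) (R : D →ₗ[ℝ] D') {J₀ : F}
    (h14 : ∀ δA : F, R (Q δA) = 0 → ⟪δA, J₀⟫ = 0) (gk : ℝ) {f : F} (hf : R (Q f) = 0) :
    gk * ⟪f, J₀⟫ = 0 := by
  rw [h14 f hf, mul_zero]

end FirstTerm364

/-! ## §2 The letters, the step values, and the bundle -/

/-- **THE LETTERS OF pp. 356–366** fixed by the construction (chosen before γ and before the run): the dimension `d` (= 4),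
the block size `L`, the cube parameters `M` (p. 357 *«a cube of the size 100M»*) and `M₀` ((1.2) *«χ({|B′| < M₀g_k⁻¹ε_k})»*),
`γ₀` ((1.7), [10] (1.67)), `δ` ∕ `δ₀` (the decay rates of (1.6)∕(1.23) and (1.27)), `β₀` ((1.23)), `A₀`, `p₀`, `A₁`, `p₁`
([III]∕[IV]: `ε_k = g_kA₀p₀(g_k)`, `δ′_k = g_kA₁p₁(g_k)`), `B₃`, `B₅` ([15]), `d(𝔤)` and `σ₀` ((1.10)), `ν`, `r₀` (p. 363, the
N-window exponents; `R_k ~ (log g_k⁻²)^{r₀}`), the profile `R(g)` with `R_k = R(g_k)` ([III] (2.5); owner ruling C-97-2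
recorded in `B16Sect1DisplaysPrinted.Consts`: read off the running coupling, never a run-frozen sequence), and every printed
`O(1)` as an explicit named constant (`C12V`∕`β12` of the p. 357 V-term `O(g_k^{1−β})`, `CF` of p. 357 Sect. F, `C17` of (1.7),
`C111`∕`C111'` of (1.11), `C358` of the p. 358 lower bound, `C120V`∕`C120Q` of p. 361, `C124`∕`C124'`∕`C124₃`∕`C124₄` of
p. 362, `C127` of (1.27), `C128`∕`C128'` of (1.28), `C129b` of p. 363, `C131` of (1.31), `C364` of p. 364, `C366c` of the p. 366
`O(N)`, `C366`∕`C366'`∕`C366''`∕`C366f` of the p. 366 bound).  Symbolic, never valued; letters only; nothing claimed.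
[cite: Balaban1989LargeFieldII, (1.6)–(1.31) pp.357–364 (the constants named there)] -/
structure Consts where
  (d p₀ p₁ : ℕ)
  (L M M₀ γ₀ δ δ₀ β₀ A₀ A₁ B₃ B₅ dg σ₀ ν r₀ : ℝ)
  /-- the profile `R(g)` of [III] (2.5): `R_j = R(g_j)` -/
  R : ℝ → ℝ
  (C12V β12 CF C17 C111 C111' C358 C120V C120Q C124 C124' C124₃ C124₄ C127 C128 C128' C129b C131 C364 C366c C366 C366'
    C366'' C366f : ℝ)

namespace Consts

/-- `ε(g) = gA₀p₀(g)` — this paper's `ε_k` read off the running coupling ([III] (2.2); p. 357 (1.6)). [cite: Balaban1989LargeFieldII, (1.6) p.357] -/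
def eps (c : Consts) (g : ℝ) : ℝ := g * c.A₀ * logPow c.p₀ g

/-- `δ′(g) = gA₁p₁(g)` — this paper's `δ′_k` ([IV] p. 182–183, used on p. 361). [cite: Balaban1989LargeFieldII, (1.20) p.361] -/
def delp (c : Consts) (g : ℝ) : ℝ := g * c.A₁ * logPow c.p₁ g

/-- `ε(g_k)` is the tree's `Setup.epsK` along the run's flow (same convention, `A₀` inside or outside the profile being
immaterial for the product). PROVED. [cite: Balaban1988Convergent, (1.4) p.246] -/
theorem eps_flow (c : Consts) (F : Flow) (k : ℕ) : c.eps (F.g k) = epsK c.A₀ c.p₀ F k := by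
  simp only [eps, epsK, p0Profile, logPow]
  ring

end Consts

/-- **THE VALUES OF pp. 357–366 AT ONE STEP OF ONE RUN** (DATA, no claim): the number `N` of preliminary steps
(`h = k − N`); the counts `|Λ|` (`volΛ`), `|𝐁₀|` (`cardB₀`), `|Λ^{(k)}∖G₀|` (`nΛG₀`); the bounded quantities of the printed
bounds — `T12V` the V-term of (1.2) (p. 357), `T16` the linear term (1.5)∕(1.6), `nA₀`∕`nGradA₀` the sizes of p. 357 Sect. F,
the fields `B′` on `Λ` vanishing on `G₀` (`Fld`) with the three numbers of (1.7)–(1.9) (`Q17` the form, `ndB` = `‖∂B′‖²`, `nB` =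
`‖B′‖²`), the `B′`-integral of (1.2)∕(1.10) (`Zint`) and `A(ζ₀, U₀)` (`A0ζ0`), the third-order term `V20` and the small
quadratic terms `Q20` of (1.20), the points of `Ω″_j ∩ Ω^c_k`, `j = h + 1, …, k` (`Pt23`, scale `sc23`) with the sizes `nH`,
`nGradH` of (1.23), the volume factor `W124` of p. 362 and the remaining two terms `T124₃`, `T124₄` of (1.24), the points of
(1.27) (`Pt27`, scale `sc27`, size `nDHB`), the values `T128`, `T128₁` of (1.28) and its first-order term, the two layer sums
`Ta`, `Tb` of (1.29), `A131` = `A(ζ₁, U₀)` of (1.31), the plaquettes of `Ω″_j∖Ω″_{j+1}` met on p. 364 (`Pt364`, scale `sc364`,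
coupling value `c364`), the plaquettes of `supp ζ` (`PtZ`, coupling value `c366`) and the second term `T366` of (1.37)
(p. 366).  TOTALITY NOTE: total data, junk-satisfiable in isolation; nothing claimed. [cite: Balaban1989LargeFieldII, (1.2)–(1.37) pp.357–366 (the quantities named there)] -/
structure StepValues where
  N : ℕ
  (volΛ cardB₀ : ℝ)
  nΛG₀ : ℕ
  (T12V T16 nA₀ nGradA₀ : ℝ)
  Fld : Type
  (Q17 ndB nB : Fld → ℝ)
  (Zint A0ζ0 V20 Q20 : ℝ)
  Pt23 : Type
  sc23 : Pt23 → ℕ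
  (nH nGradH : Pt23 → ℝ)
  (W124 T124₃ T124₄ : ℝ)
  Pt27 : Type
  sc27 : Pt27 → ℕ
  nDHB : Pt27 → ℝ
  (T128 T128₁ Ta Tb A131 : ℝ)
  Pt364 : Type
  sc364 : Pt364 → ℕ
  c364 : Pt364 → ℝ
  PtZ : Type
  c366 : PtZ → ℝ
  T366 : ℝ

/-- **THE PRINTED REAL-LETTER STATEMENTS OF pp. 357–366 AT STEP `k` OF THE RUN `D`, ON THE VALUES `v`, WITH THE LETTERS
`c`** — a conjunction (a `structure … : Prop`, one named field per printed statement), EVERY conjunct a quoted leaf BY NAME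
(the tree's `Prop`s of `B16Sect1Wilson` ∕ `B16Sect1Statements` ∕ `B16Sect1Kernels`, or a §1 slot of this file), every threshold read off the run's flow `D.flow.g` (`g_k`, `ε_k = ε(g_k)`, `δ′_k = δ′(g_k)`, `p₀(g_k)`, `p₁(g_k)`,
`R_k = R(g_k)`, `R_{h+1} = R(g_{h+1})`, `h = k − N`; `L^jη = scaleLen L k j`): p. 357 `LambdaCube357Printed`, p. 357 V-term
`Ineq12V`, (1.6) `Ineq16`, p. 357 Sect. F `RepF357Printed`, (1.7)–(1.9) `Ineq17`∕`Ineq18`∕`Ineq19` for every `B′`, p. 358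
`DenomLower358`, (1.10)–(1.11) `Ineq111` for `I(U₀) = I110 …` with `E_k(Λ) = Ek110 …`, p. 361 `CardB0Le361Printed`,
`Ineq120V`, `Ineq120Q`, `NWindowUpper`, (1.23) `Ineq123` at every listed point, (1.24) `Ineq124snd` and
`Ineq124Rest362Printed`, (1.27) `Ineq127` at every listed point, (1.28) `Ineq128simple`∕`Ineq128first`, (1.29)
`Ineq129a`∕`Ineq129b`, p. 363 `NWindowLower`∕`NuCondition363`, (1.31) `Ineq131`, p. 364 `CouplingDiff364Printed` on every
listed plaquette, p. 366 `CouplingDiff366`∕`Ineq366`∕`Ineq366final`.  A `Prop`; nothing asserted.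
[cite: Balaban1989LargeFieldII, (1.6)–(1.37) pp.357–366] -/
structure BoundsAt (D : B16.RunData) (k : ℕ) (v : StepValues) (c : Consts) : Prop where
  /-- p. 357: `|Λ| ≦ (100M)^d` -/
  lam357 : LambdaCube357Printed v.volΛ c.M c.d
  /-- p. 357: the V-term of (1.2) is `O(g_k^{1−β})|Λ|` -/
  i12V : Ineq12V v.T12V c.C12V (D.flow.g k) c.β12 v.volΛ
  /-- (1.6) -/
  i16 : Ineq16 v.T16 c.B₃ c.M₀ c.A₀ (logPow c.p₀ (D.flow.g k)) (c.R (D.flow.g k)) c.M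
  /-- p. 357: Sect. F [15] representation bound -/
  repF : RepF357Printed v.nA₀ v.nGradA₀ c.CF c.M (c.R (D.flow.g k)) (c.eps (D.flow.g k))
  /-- (1.7), for every `B′` -/
  i17 : ∀ f : v.Fld, Ineq17 (v.Q17 f) (v.ndB f) (v.nB f) c.γ₀ c.C17 c.M (c.R (D.flow.g k)) (c.eps (D.flow.g k))
  /-- (1.8), for every `B′` -/
  i18 : ∀ f : v.Fld, Ineq18 (v.nB f) (v.ndB f) c.d c.M
  /-- (1.9), for every `B′` -/
  i19 : ∀ f : v.Fld, Ineq19 (v.Q17 f) (v.nB f) c.γ₀ c.d c.M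
  /-- p. 358: the denominator integral is `≧ exp(−O(1)|Λ|)` -/
  den358 : DenomLower358 v.Zint c.C358 v.volΛ
  /-- (1.11) for the `I(U₀)` defined by (1.10) -/
  i111 : Ineq111 (I110 (D.flow.g k) v.A0ζ0 (Ek110 c.dg (D.flow.g k) c.σ₀ v.nΛG₀) v.Zint) c.C111 c.C111' c.M v.volΛ
  /-- p. 361: `|𝐁₀| ≦ (100MR_k)^dN²` -/
  b0card : CardB0Le361Printed v.cardB₀ c.M (c.R (D.flow.g k)) v.N c.d
  /-- p. 361: the third-order term of (1.20) -/
  i120V : Ineq120V v.V20 c.C120V v.cardB₀ (c.delp (D.flow.g k))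
  /-- p. 361: the small quadratic terms of (1.20) -/
  i120Q : Ineq120Q v.Q20 c.C120Q c.B₃ c.B₅ c.M c.A₁ (logPow c.p₁ (D.flow.g k)) (c.eps (D.flow.g k)) v.cardB₀
  /-- p. 361: *«We have assumed here that N ≦ R_k»* -/
  winUp : NWindowUpper v.N (c.R (D.flow.g k))
  /-- (1.23) on `Ω″_j ∩ Ω^c_k`, `j = h + 1, …, k` -/
  i123 : ∀ x : v.Pt23, Ineq123 (scaleLen c.L k (v.sc23 x)) (v.nH x) (v.nGradH x) c.B₃ c.δ c.M
    (c.R (D.flow.g (k - v.N + 1))) c.d c.β₀ (c.R (D.flow.g k)) (c.eps (D.flow.g k))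
  /-- p. 362: the second term of (1.24) -/
  i124 : Ineq124snd c.C124 c.B₃ c.B₅ c.M (c.eps (D.flow.g k)) c.δ (c.R (D.flow.g (k - v.N + 1))) c.d c.β₀
    (c.R (D.flow.g k)) v.W124 (D.flow.g k) c.C124' c.A₀ (logPow c.p₀ (D.flow.g k))
  /-- p. 362: *«Similar, or better, bounds hold for the remaining two terms»* -/
  i124rest : Ineq124Rest362Printed v.T124₃ v.T124₄ (D.flow.g k) c.C124₃ c.C124₄ c.A₀ c.B₃ c.B₅ c.M (c.R (D.flow.g k))
    (logPow c.p₀ (D.flow.g k)) c.d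
  /-- (1.27) at scale `j` -/
  i127 : ∀ y : v.Pt27, Ineq127 (v.nDHB y) c.C127 (scaleLen c.L k (v.sc27 y)) c.δ₀ c.M (c.R (D.flow.g (k - v.N + 1)))
    c.A₁ (logPow c.p₁ (D.flow.g k))
  /-- (1.28), the simple estimate -/
  i128s : Ineq128simple v.T128 (D.flow.g k) c.C128 c.A₀ c.B₃ c.B₅ c.M (c.R (D.flow.g k)) (logPow c.p₀ (D.flow.g k)) c.d
  /-- (1.28), the first-order term -/
  i128f : Ineq128first v.T128₁ (D.flow.g k) c.C128 c.A₀ c.B₃ c.B₅ c.M (c.R (D.flow.g k)) (logPow c.p₀ (D.flow.g k)) c.d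
    c.δ (c.R (D.flow.g (k - v.N + 1))) c.β₀ (c.eps (D.flow.g k)) c.C128'
  /-- (1.29), the layer at `∂Ω_k` -/
  i129a : Ineq129a v.Ta (D.flow.g k) c.M (c.R (D.flow.g k)) c.d c.B₃ c.A₀ (logPow c.p₀ (D.flow.g k)) c.δ
    (c.eps (D.flow.g k))
  /-- (1.29), the layer at `∂Ω″_{h+1}` (`L^hη = scaleLen L k (k − N)`) -/
  i129b : Ineq129b v.Tb (D.flow.g k) (scaleLen c.L k (k - v.N)) c.M (c.R (D.flow.g (k - v.N + 1))) c.d c.B₃ c.A₀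
    (logPow c.p₀ (D.flow.g k)) c.C129b c.B₅ (c.eps (D.flow.g k))
  /-- p. 363: `L^{−N} ≦ (log g_k⁻²)^{−ν}` -/
  winLow : NWindowLower c.L v.N (Real.log ((D.flow.g k) ^ 2)⁻¹) c.ν
  /-- p. 363: `ν ≧ 2p₀ + dr₀` -/
  nu363 : NuCondition363 c.ν (c.p₀ : ℝ) c.r₀ c.d
  /-- (1.31) -/
  i131 : Ineq131 v.A131 (D.flow.g k) c.L⁻¹ v.N c.β₀ c.C131 c.A₀ c.B₃ c.B₅ c.M (c.R (D.flow.g k))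
    (logPow c.p₀ (D.flow.g k))
  /-- p. 364: the coupling difference on `Ω″_j∖Ω″_{j+1}` -/
  c364 : ∀ x : v.Pt364, CouplingDiff364Printed (v.c364 x) (D.flow.g k) c.C364 k (v.sc364 x)
  /-- p. 366: the coupling difference `O(N)` on `supp ζ` -/
  c366 : ∀ z : v.PtZ, CouplingDiff366 (v.c366 z) (D.flow.g k) c.C366c v.N
  /-- p. 366: the bound on the second term of (1.37) -/
  i366 : Ineq366 v.T366 c.C366 v.N c.β₀ c.M (c.R (D.flow.g k)) c.C366' c.B₃ c.B₅ (c.eps (D.flow.g k)) c.C366''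
    (c.delp (D.flow.g k))
  /-- p. 366: its printed final form -/
  i366f : Ineq366final v.T366 c.C366f c.B₃ c.B₅ c.M (c.R (D.flow.g k)) (c.eps (D.flow.g k))

/-- **[Balaban1989LargeFieldII] pp. 357–366 AS ONE HYPOTHESIS FOR A CONSTRUCTION** (the bundle of CARVE-RULES §2.5, pattern
`B16.Thm1Printed` ∕ `B16Sect1DisplaysPrinted.Sect1DisplaysPrinted`).  p. 355 Theorem 1, verbatim: *«If the sequence of the
effective coupling constants is contained in an interval ]0, γ] with a sufficiently small positive γ, then the effective
densities ρ_k have the form, and satisfy all the conditions and bounds, described in Sect. 2 [III].»*; the localization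
stage of its proof, Sect. 1 pp. 356–366, establishes at every step `k ≦ K` of such a run the bounds conjoined in `BoundsAt`
(each *«for g_k sufficiently small»* — absorbed in the threshold `γ` — and under the N-window of pp. 361∕363, itself a
conjunct).  Typed: for the values `X P k` read off each run `P` at each step `k` and the construction's letters `c`, *there
is γ > 0 such that for every run whose effective couplings satisfy `0 < g_j ≦ γ` (`Setup.Flow.InInterval`) and every step
`k ≦ K`, `BoundsAt (C P) k (X P k) c`*.  HYPOTHESIS SHAPE ONLY — consumed as `(h : Hyp C X c)`; never proved here, never
asserted; Theorem 1 itself and (0.1) are `B16.Thm1Printed` ∕ `B16.UVBound01` ∕ `B16.EndStatementBPrinted` and are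
deliberately NOT conjuncts (they are the consumer's conclusion). [cite: Balaban1989LargeFieldII, Thm 1 p.355 with (1.6)–(1.37) pp.357–366] -/
def Hyp (C : B16.Construction) (X : B12.RunParams → ℕ → StepValues) (c : Consts) : Prop :=
  ∃ γ : ℝ, 0 < γ ∧ ∀ P : B12.RunParams, (C P).flow.InInterval γ P.K → ∀ k, k ≤ P.K → BoundsAt (C P) k (X P k) c

/-! ## §3 Bookkeeping a consumer cites (PROVED; `And`-elimination and the tree's arithmetic by name) -/

section Bookkeeping

variable {C : B16.Construction} {X : B12.RunParams → ℕ → StepValues} {c : Consts}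

/-- Under `Hyp`: the window `γ` and, inside it, the whole conjunction at every step (definitional unfolding, recorded for
citation). [cite: Balaban1989LargeFieldII, Thm 1 p.355] -/
theorem Hyp.boundsAt (h : Hyp C X c) :
    ∃ γ : ℝ, 0 < γ ∧ ∀ P : B12.RunParams, (C P).flow.InInterval γ P.K → ∀ k, k ≤ P.K → BoundsAt (C P) k (X P k) c :=
  h

/-- Under `Hyp`: (1.9) for every `B′` at every step in the window — the Prop. 1 [IV] input (p. 358 *«It allows us to prove
Proposition 1 [IV]»*), by `And`-elimination. [cite: Balaban1989LargeFieldII, (1.9) p.358] -/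
theorem Hyp.ineq19_of (h : Hyp C X c) :
    ∃ γ : ℝ, 0 < γ ∧ ∀ P : B12.RunParams, (C P).flow.InInterval γ P.K → ∀ k, k ≤ P.K →
      ∀ f : (X P k).Fld, Ineq19 ((X P k).Q17 f) ((X P k).nB f) c.γ₀ c.d c.M := by
  obtain ⟨γ, hγ, hall⟩ := h
  exact ⟨γ, hγ, fun P hP k hk => (hall P hP k hk).i19⟩

/-- Under `Hyp`: (1.31) at every step in the window, by `And`-elimination. [cite: Balaban1989LargeFieldII, (1.31) p.364] -/
theorem Hyp.ineq131_of (h : Hyp C X c) :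
    ∃ γ : ℝ, 0 < γ ∧ ∀ P : B12.RunParams, (C P).flow.InInterval γ P.K → ∀ k, k ≤ P.K →
      Ineq131 (X P k).A131 ((C P).flow.g k) c.L⁻¹ (X P k).N c.β₀ c.C131 c.A₀ c.B₃ c.B₅ c.M (c.R ((C P).flow.g k))
        (logPow c.p₀ ((C P).flow.g k)) := by
  obtain ⟨γ, hγ, hall⟩ := h
  exact ⟨γ, hγ, fun P hP k hk => (hall P hP k hk).i131⟩

variable {D : B16.RunData} {k : ℕ} {v : StepValues}

/-- KNIT (1.11) × p. 357: the bundle's site-count conjunct is exactly the `hvol` of the tree's arithmetic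
`B16Sect1Wilson.ineq111_arith`, so at `d = 4`, `M ≧ 1`, `O(1) ≧ 0`, `|Λ| ≧ 0` the printed *«O(1) log M|Λ| < O(1)M⁵»* step
holds with `O(1) = C·100⁴`. PROVED by name. [cite: Balaban1989LargeFieldII, (1.11) p.358] -/
theorem BoundsAt.logM_volΛ_le (h : BoundsAt D k v c) (hd : c.d = 4) (hC : 0 ≤ c.C111) (hM : 1 ≤ c.M)
    (hvol0 : 0 ≤ v.volΛ) : c.C111 * Real.log c.M * v.volΛ ≤ c.C111 * 100 ^ 4 * c.M ^ 5 := by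
  have hvol : v.volΛ ≤ (100 * c.M) ^ 4 := by simpa [LambdaCube357Printed, hd] using h.lam357
  exact ineq111_arith c.C111 c.M v.volΛ hC hM hvol0 hvol

/-- KNIT p. 358 × p. 357: *«exp(−O(1)|Λ|) = exp(−O(M⁴))»* — the bundle's `DenomLower358` and `LambdaCube357Printed`
conjuncts feed `B16Sect1Statements.denomLower358_M4` (`d = 4`, `O(1) ≧ 0`). PROVED by name. [cite: Balaban1989LargeFieldII, p.358 (before (1.10))] -/
theorem BoundsAt.denom_M4 (h : BoundsAt D k v c) (hd : c.d = 4) (hC : 0 ≤ c.C358) :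
    Real.exp (-(c.C358 * 100 ^ 4 * c.M ^ 4)) ≤ v.Zint := by
  have hvol : v.volΛ ≤ (100 * c.M) ^ 4 := by simpa [LambdaCube357Printed, hd] using h.lam357
  exact denomLower358_M4 hC hvol h.den358

/-- KNIT p. 361: the printed chain `O(1)|𝐁₀|δ′_k³ ≦ O(1)(100MR_k)^dN²δ′_k³ ≦ g_k³O(1)M^dR_k^{d+2}A₁³p₁³(g_k)` follows from the
bundle's conjuncts `CardB0Le361Printed` (`hB₀`) and `NWindowUpper` (`hN`) by the tree's `B16Sect1Statements.ineq120V_arith`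
(with `δ′_k = g_kA₁p₁(g_k)` by definition of `Consts.delp`). PROVED by name. [cite: Balaban1989LargeFieldII, (1.20) p.361] -/
theorem BoundsAt.thirdOrder_chain (h : BoundsAt D k v c) (hC : 0 ≤ c.C120V) (hδ : 0 ≤ c.delp (D.flow.g k))
    (hM : 0 ≤ c.M) (hRk : 0 ≤ c.R (D.flow.g k)) :
    c.C120V * v.cardB₀ * c.delp (D.flow.g k) ^ 3 ≤
        c.C120V * ((100 * c.M * c.R (D.flow.g k)) ^ c.d * (v.N : ℝ) ^ 2) * c.delp (D.flow.g k) ^ 3 ∧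
      c.C120V * ((100 * c.M * c.R (D.flow.g k)) ^ c.d * (v.N : ℝ) ^ 2) * c.delp (D.flow.g k) ^ 3 ≤
        (D.flow.g k) ^ 3 * (c.C120V * 100 ^ c.d) * c.M ^ c.d * c.R (D.flow.g k) ^ (c.d + 2) * c.A₁ ^ 3 *
          logPow c.p₁ (D.flow.g k) ^ 3 :=
  ineq120V_arith hC hδ hM hRk h.b0card h.winUp rfl

/-- KNIT p. 366: *«= O(N) ≦ O(R_k) on the support of ζ»* — the bundle's `CouplingDiff366` and `NWindowUpper` conjuncts give
`|1/(g″_k(·))² − 1/g_k²| ≦ O(1)R_k` at every plaquette of `supp ζ`, by the tree's `B16Sect1Statements.couplingDiff366_le_Rk`.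
PROVED by name. [cite: Balaban1989LargeFieldII, p.366 (after (1.37))] -/
theorem BoundsAt.coupling366_le_Rk (h : BoundsAt D k v c) (hC : 0 ≤ c.C366c) (z : v.PtZ) :
    |v.c366 z - 1 / (D.flow.g k) ^ 2| ≤ c.C366c * c.R (D.flow.g k) :=
  couplingDiff366_le_Rk hC (h.c366 z) h.winUp

/-- KNIT (1.7) ∧ (1.8) ⇒ (1.9): inside the bundle the three conjuncts are mutually consistent in the tree's sense — given
the printed smallness proviso of `B16Sect1Wilson.ineq19_of_17_18` (*«for g_k sufficiently small»*), (1.7) and (1.8) at a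
field `B′` re-derive the (1.9) conjunct. PROVED by name. [cite: Balaban1989LargeFieldII, (1.9) p.358] -/
theorem BoundsAt.ineq19_rederived (h : BoundsAt D k v c) (hd : 1 ≤ c.d) (hM : 0 < c.M) (hγ : 0 ≤ c.γ₀) (f : v.Fld)
    (hnB : 0 ≤ v.nB f)
    (hsmall : c.C17 * (c.M ^ 6 * c.R (D.flow.g k) * c.eps (D.flow.g k) + Real.exp (-c.R (D.flow.g k))) ≤
      c.γ₀ / (2 * c.d * (100 * c.M) ^ (c.d + 1))) :
    Ineq19 (v.Q17 f) (v.nB f) c.γ₀ c.d c.M :=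
  ineq19_of_17_18 hd hM hγ hnB (h.i17 f) (h.i18 f) hsmall

end Bookkeeping

end

end Literature.MathematicalPhysics.QuantumFieldTheory.Balaban1983to89.B16Carve38Thm1LocalizationHyp
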